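import Summits.ABC.IUTFork.Joshi.TestGenuinePinsVacuityQuadratic
import Literature.NumberTheory.QuadraticFields.FundamentalDiscriminant
import HarnessLib

/-!
# Branch E TEST — the genuine-carrier pins are UNSATISFIABLE over EVERY number field of degree `2`, hypothesis-free

Proof-only sequel (abc-iut cell, D-0079 R-J «Joshi Y-discharge census», row Y-26 residual class; seat abc-iut-E-t43, gen 4; 0 definitions,
no `Prop` fact, FACT rows used: none) to this seat's `Joshi/TestGenuinePinsVacuityQuadratic.lean` (p461750), whose
`not_pinnedRegions_settingPrVolSharp_of_quadratic` takes the presentation `F ∋ s`, `s² = d`, `d` squarefree `≠ 1`.  Here that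
presentation is DISCHARGED from `[F : ℚ] = 2` alone by the tree's classical quadratic-field facts
(`Literature.NumberTheory.QuadraticFields.Quadratic.exists_sq_eq_discr`: `d_F = δ²` for some `δ ∈ 𝓞 F`;
`…isFundamentalDiscriminant_discr`: `d_F ≡ 1 (mod 4)` squarefree `≠ 1`, or `d_F = 4m` with `m ≡ 2, 3 (mod 4)` squarefree — Marcus,
*Number Fields*, Ch. 2 Thm. 1; Hermite–Minkowski `|d_F| > 2`), consumed BY NAME:

* **`not_pinnedRegions(3)_settingPrVolSharp_of_finrank_eq_two`** — for EVERY number field `F` with `[F : ℚ] = 2`, the three region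
  pins of [IUTchIII] Cor. 3.12 instantiated on the Dupuy–Hilado carriers (abc-iut-c312-7's `settingPrVolSharp` over
  `LatticeSituation.ofShells (logShellsDH X (analyticLogv F)) …`) FAIL for the analytic logarithms — EVERY `X : PilotData F`, `ρ`, `qK`,
  column data, `Ψ`, ideles, column (`s = δ`, `d = d_F`, resp. `s = δ/2`, `d = d_F/4`).

CONSEQUENCE FOR THE RECORD (tree currency, no side taken): over quadratic fields the genuine-carrier clauses «(ii)(b)@n ∧ (pΘ) ∧ (pq′) ⟹ ¬S»
(p430714 / p436213 / p438843) are VACUOUS with NO arithmetic side condition and NO initial Θ-datum.  HONEST SCOPE: OUR interface, OUR sharp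
real container, Dupuy–Hilado's reading of (Ind2); nothing here bears on print's (xi-e)/(xi-f); locates / conditionally verifies; no abc
claim. [claim: Mochizuki2012, status: disputed] [cite: DupuyHilado2025, §4.9] [cite: NeukirchANT1999, Ch. II Prop. (5.3), (5.7), (6.8)]
-/

noncomputable section

open Set Function NumberField IsDedekindDomain Metric
open scoped Pointwise

namespace Summit.ABC.IUTFork.Joshi

open Thm311 Thm311.Real Cor312 Cor312Vol Literature.IUT.LogThetaLattice Literature.IUT.LogVolume
  Literature.IUT.HodgeTheaters Literature.NumberTheory.NumberFields
open Literature.NumberTheory.QuadraticFields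

variable {F : Type} [Field F] [NumberField F] (X : PilotData F)
  (M : Type) [Field M] [NumberField M]
  (archPk : ∀ (j : (thetaIndex X).Label) (vQ : (thetaIndex X).VQ), Set ((logShellsDH X (analyticLogv F)).Packet j vQ))
  (archSub : ∀ (j : (thetaIndex X).Label) (v : (thetaIndex X).V),
    Set ((logShellsDH X (analyticLogv F)).Packet j ((thetaIndex X).over v)))
  (Ψ : ℤ → ∀ v : (thetaIndex X).V, v ∈ (thetaIndex X).Vbad → Set ((logShellsDH X (analyticLogv F)).StarPacket v))
  (act : ℤ → ∀ v : (thetaIndex X).V, v ∈ (thetaIndex X).Vbad →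
    (logShellsDH X (analyticLogv F)).StarPacket v → Module.End ℚ ((logShellsDH X (analyticLogv F)).StarPacket v))
  (Mmod : ℤ → ∀ j : (thetaIndex X).LabelStar, Set ((logShellsDH X (analyticLogv F)).GlobalPacket j.1))
  (region : ℤ → ∀ j : (thetaIndex X).LabelStar, FinDivisor M → ∀ vQ : (thetaIndex X).VQ,
    Set ((logShellsDH X (analyticLogv F)).Packet j.1 vQ))
  (frobAdm : ℤ → ℤ → ∀ (j : (thetaIndex X).Label) (vQ : (thetaIndex X).VQ),
    Set ((logShellsDH X (analyticLogv F)).Packet j vQ) → Prop)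
  (frobLogvol : ℤ → ℤ → ∀ (j : (thetaIndex X).Label) (vQ : (thetaIndex X).VQ),
    Set ((logShellsDH X (analyticLogv F)).Packet j vQ) → ℝ)
  (frobΨ : ℤ → ℤ → ∀ v : (thetaIndex X).V, v ∈ (thetaIndex X).Vbad → Set ((logShellsDH X (analyticLogv F)).StarPacket v))
  (frobMmod : ℤ → ℤ → ∀ j : (thetaIndex X).LabelStar, Set ((logShellsDH X (analyticLogv F)).GlobalPacket j.1))
  (unitImage : ℤ → ℤ → ℕ → ∀ (j : (thetaIndex X).Label) (vQ : (thetaIndex X).VQ),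
    Set ((logShellsDH X (analyticLogv F)).Packet j vQ))
  (ballImage : ℤ → ℤ → ∀ (j : (thetaIndex X).Label) (vQ : (thetaIndex X).VQ),
    Set ((logShellsDH X (analyticLogv F)).Packet j vQ))
  (thetaDiv : ℤ → ℤ → LgpDivisor M (thetaIndex X).lstar)
  (n : ℤ) {HT : Type} {LogLink : HT → HT → Type} {IsFull : ∀ {s t : HT}, LogLink s t → Prop}
  (lat : LGPGaussianLogThetaLattice LogLink IsFull)
  {Frd : Type} {IsoF : Frd → Frd → Type} {Ob : Frd → Type} {realify : Frd → Frd} {Strip : Type}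
  {IsoS : Strip → Strip → Type} {Mv : ∀ v : (thetaIndex X).V, v ∈ (thetaIndex X).Vbad → Type}
  [∀ v h, Monoid (Mv v h)]
  (sig : GlobalLGPFrobenioidSignature (thetaIndex X).lstar (thetaIndex X).V (· ∈ (thetaIndex X).Vbad)
    Frd IsoF Ob realify Strip IsoS Mv)
  (split : SplittingMonoids Mv) {ObΔ : Type} {N : ∀ v : (thetaIndex X).V, v ∈ (thetaIndex X).Vbad → Type}
  [∀ v h, Monoid (N v h)] (qData : QPilotData ObΔ N)
  (t : ∀ (pp : Nat.Primes) (_ : Fin X.lstar) (x : (thetaIndex X).Fibre (.inr pp)),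
    haveI : Fact (pp : ℕ).Prime := ⟨pp.2⟩; kOf X pp.1 x)
  (tq : ∀ (pp : Nat.Primes) (x : (thetaIndex X).Fibre (.inr pp)), haveI : Fact (pp : ℕ).Prime := ⟨pp.2⟩; kOf X pp.1 x)
  (ρ : (∀ v : (thetaIndex X).V, v ∈ (thetaIndex X).Vbad → Set ((logShellsDH X (analyticLogv F)).StarPacket v)) →
    ∀ (j : (thetaIndex X).Label) (vQ : (thetaIndex X).VQ), Set ((logShellsDH X (analyticLogv F)).Packet j vQ))
  (qK : ∀ v : (thetaIndex X).V, v ∈ (thetaIndex X).Vbad → Set ((logShellsDH X (analyticLogv F)).StarPacket v))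
  (htq0 : ∀ pp x, tq pp x ≠ 0)
  (htq1 : ∀ (pp : Nat.Primes) (x : (thetaIndex X).Fibre (.inr pp)),
    haveI : Fact (pp : ℕ).Prime := ⟨pp.2⟩; placeOf X pp.1 x ∉ X.S → ‖tq pp x‖ = 1)

/-- **EVERY NUMBER FIELD OF DEGREE `2`: `PinnedRegions` FAILS at `settingPrVolSharp`** for the analytic logarithms — every
`X : PilotData F`, `ρ`, `qK`, column data, `Ψ`, ideles, column; `F = ℚ(√d_F)` with `d_F` a fundamental discriminant (tree
`Quadratic.exists_sq_eq_discr`, `Quadratic.isFundamentalDiscriminant_discr`), then `not_pinnedRegions_settingPrVolSharp_of_quadratic`.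
[cite: DupuyHilado2025, §4.9] [cite: NeukirchANT1999, Ch. II Prop. (5.3), (5.7), (6.8)] [claim: Mochizuki2012, status: disputed] -/
theorem not_pinnedRegions_settingPrVolSharp_of_finrank_eq_two (hF : Module.finrank ℚ F = 2) :
    ¬ Cor312Vol.PinnedRegions
      (LatticeSituation.ofShells (logShellsDH X (analyticLogv F)) M archPk archSub
        (summandPiecesPr X (logvAnalytic_analyticLogv (F := F))).Adm
        (summandPiecesPr X (logvAnalytic_analyticLogv (F := F))).logvol Ψ act Mmod region frobAdm frobLogvol frobΨ frobMmod
        unitImage ballImage thetaDiv)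
      (settingPrVolSharp X (logvAnalytic_analyticLogv (F := F)) M archPk archSub Ψ act Mmod region n lat sig split qData tq t
        htq0 htq1) ρ qK := by
  obtain ⟨-, -, δ, -, hδ⟩ := Quadratic.exists_sq_eq_discr (K := F) hF
  have hδF : ((δ : F)) ^ 2 = ((NumberField.discr F : ℤ) : F) := by
    have h := congrArg (algebraMap (𝓞 F) F) hδ
    rwa [map_pow, map_intCast] at h
  rcases Quadratic.isFundamentalDiscriminant_discr (K := F) hF with ⟨-, hsq, hne⟩ | ⟨h4, hm, hsq⟩
  · exact not_pinnedRegions_settingPrVolSharp_of_quadratic X M archPk archSub Ψ act Mmod region frobAdm frobLogvol frobΨ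
          frobMmod unitImage ballImage thetaDiv n lat sig split qData t tq ρ qK htq0 htq1 hF hδF hsq hne
  · -- `d_F = 4m`: `F ∋ δ/2` with `(δ/2)² = m`, `m ≡ 2, 3 (mod 4)` squarefree, `m ≠ 1`
    set m : ℤ := NumberField.discr F / 4 with hmdef
    have hDm : NumberField.discr F = 4 * m := by rw [hmdef]; exact (Int.mul_ediv_cancel' h4).symm
    have h20 : (2 : F) ≠ 0 := two_ne_zero
    have hs : ((δ : F) / 2) ^ 2 = (m : F) := by
      rw [div_pow, hδF, hDm]; push_cast; field_simp; ring
    exact not_pinnedRegions_settingPrVolSharp_of_quadratic X M archPk archSub Ψ act Mmod region frobAdm frobLogvol frobΨ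
          frobMmod unitImage ballImage thetaDiv n lat sig split qData t tq ρ qK htq0 htq1 hF hs hsq (by omega)

/-- The same for `PinnedRegions3`. [claim: Mochizuki2012, status: disputed] -/
theorem not_pinnedRegions3_settingPrVolSharp_of_finrank_eq_two (hF : Module.finrank ℚ F = 2) :
    ¬ Cor312Vol.PinnedRegions3
      (LatticeSituation.ofShells (logShellsDH X (analyticLogv F)) M archPk archSub
        (summandPiecesPr X (logvAnalytic_analyticLogv (F := F))).Adm
        (summandPiecesPr X (logvAnalytic_analyticLogv (F := F))).logvol Ψ act Mmod region frobAdm frobLogvol frobΨ frobMmod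
        unitImage ballImage thetaDiv)
      (settingPrVolSharp X (logvAnalytic_analyticLogv (F := F)) M archPk archSub Ψ act Mmod region n lat sig split qData tq t
        htq0 htq1) ρ qK :=
  fun h => not_pinnedRegions_settingPrVolSharp_of_finrank_eq_two X M archPk archSub Ψ act Mmod region frobAdm frobLogvol frobΨ
          frobMmod unitImage ballImage thetaDiv n lat sig split qData t tq ρ qK htq0 htq1 hF h.1

end Summit.ABC.IUTFork.Joshi

end
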